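import Mathlib
import Summits.Ventures.HodgeRepro.Tier4.Line1.RTFSetting
import Summits.Ventures.HodgeRepro.Tier4.Line1.RealisedSetting
import Summits.Ventures.HodgeRepro.Tier4.Line1.LeftTypeOfMatrixCoeff
import Summits.Ventures.HodgeRepro.Tier4.Line1.ArchMatrixCoeff
import Summits.Ventures.HodgeRepro.Tier4.Line1.IsolatingTestsDeepLevel
import Summits.Ventures.HodgeRepro.Tier4.Line1.FiniteTypeAlgebra
import Summits.Ventures.HodgeRepro.Tier4.Line1.TotallyDefiniteBridge
import Summits.Ventures.HodgeRepro.Tier4.Line1.IsolatingTestsFiniteRankTypeBiInvariant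

/-!
# Tier4/Line1/IsolatingTestsFiniteRankTypeTower — the bi-invariant typed pair of (S1b) ∧ F2′ in TOWER FORM: ONE pair
serves every deep enough level

Blind re-derivation cell `pub-hodge-repro`, Tier 4 (README §9–§10), seat t4-L1-p4 (gen 4), LINE L1; the tower form of
cut (a) (t4-plan-1 S14297), mirroring the tower form of F2′ (`defined_inputs_realisable_deepLevel`, p684914).  Target
tree path `lean/Summits/Ventures/HodgeRepro/Tier4/Line1/IsolatingTestsFiniteRankTypeTower.lean`.  Imports this seat's
IsolatingTestsFiniteRankTypeBiInvariant, TotallyDefiniteBridge and IsolatingTestsDeepLevel (`levelK_antitone`), p2's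
FiniteTypeAlgebra (`finLevel_antitone`).  0 print.

WHAT IS PROVED.  `HasFiniteRankLeftType.mono`: a finite-rank left-`K`-type restricts to every subgroup `K' ≤ K` (same
rank, same coefficients).  Hence **`exists_isolating_tests_finiteRankType_biInvariant_tower`**: with
`hC : IsCompact (archImage W)` there are `N₀ ≠ 0` and ONE isolating pair `(f₁, f₂, o₀)` such that for EVERY multiple
`N` of `N₀`, `f₁` is of finite-rank left-`finLevel W N`-type and bi-`levelK W N`-invariant (the levels are antitone:
`finLevel W N ≤ finLevel W N₀`, `levelK W N ≤ levelK W N₀`); the DEFINED-block form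
`defined_inputs_realisable_finiteRankType_biInvariant_tower` in the binder shape of p684914 (`∀ N, N ≠ 0 → N₀ ∣ N →
∃ f₁ f₂ o₀, …`), and the `_of_totallyDefinite` twins.  A consumer that fixes its level elsewhere (a Hecke algebra at
level `N`, row (6)) may take the block at that level as soon as `N₀ ∣ N`.  Nothing here says anything about the status
of the Hodge conjecture for CM abelian varieties, which is NOT proved (HC_CM is NOT proved by anyone in this
repository).
-/

set_option autoImplicit false

noncomputable section

namespace Summit.Ventures.HodgeRepro.Tier4.Line1

open MeasureTheory Topology NumberField Common

namespace RTF

variable {G : Type} [Group G] [TopologicalSpace G]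

/-- a finite-rank left-`K`-type restricts to any subgroup `K' ≤ K` (same rank, the coefficients restricted). -/
theorem HasFiniteRankLeftType.mono {K K' : Subgroup G} (hle : K' ≤ K) {f : G → ℂ}
    (hf : HasFiniteRankLeftType K f) : HasFiniteRankLeftType K' f := by
  obtain ⟨r, e, c, hc, hdec⟩ := hf
  exact ⟨r, fun i k => e i ⟨(k : G), hle k.2⟩, c, hc, fun k g => hdec ⟨(k : G), hle k.2⟩ g⟩

end RTF

section Instance

variable {k : Type} [Field k] [NumberField k] (W : PlaneData k) [MeasurableSpace (GA W)] [BorelSpace (GA W)]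
  (hW : IsDefinite W) (hg : IsGenuineRow W) (R : RTFData W) (μ : Measure (GA W)) [μ.IsHaarMeasure]
  [R.μT.IsHaarMeasure] [R.μT'.IsHaarMeasure] (hT : IsCompact (closure R.DT)) (hT' : IsCompact (closure R.DT'))

/-- **the bi-invariant typed pair in tower form**: ONE pair `(f₁, f₂, o₀)` and `N₀ ≠ 0` such that for every multiple
`N` of `N₀`, `f₁` is of finite-rank left-`finLevel W N`-type and bi-`levelK W N`-invariant. -/
theorem exists_isolating_tests_finiteRankType_biInvariant_tower (hC : IsCompact (archImage W))
    (hc : Continuous R.chi) (hu : ∀ a, ‖R.chi a‖ = 1) (hc' : Continuous R.chi') (hu' : ∀ a, ‖R.chi' a‖ = 1) :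
    ∃ (N₀ : ℕ) (f₁ f₂ : GA W → ℂ) (o₀ : (Setting.ofAdelic W hW hg R μ hT hT').Orbit), N₀ ≠ 0 ∧
      RTF.IsTest f₁ ∧ RTF.IsTest f₂ ∧ RTF.IsTest ((Setting.ofAdelic W hW hg R μ hT hT').conv f₁ f₂) ∧
      (Setting.ofAdelic W hW hg R μ hT hT').geoSupport ((Setting.ofAdelic W hW hg R μ hT hT').conv f₁ f₂) = {o₀} ∧
      (Setting.ofAdelic W hW hg R μ hT hT').orbital R.chi R.chi' o₀
        ((Setting.ofAdelic W hW hg R μ hT hT').conv f₁ f₂) ≠ 0 ∧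
      ∀ N : ℕ, N₀ ∣ N → RTF.HasFiniteRankLeftType (finLevel W N) f₁ ∧
        ∀ k ∈ levelK W N, ∀ x, f₁ (x * k) = f₁ x ∧ f₁ (k * x) = f₁ x := by
  obtain ⟨N₀, f₁, f₂, o₀, hN₀, h₁, h₂, hconv, hiso, hne, htype, hinv⟩ :=
    exists_isolating_tests_finiteRankType_biInvariant W hW hg R μ hT hT' hC hc hu hc' hu'
  refine ⟨N₀, f₁, f₂, o₀, hN₀, h₁, h₂, hconv, hiso, hne, fun N hdvd => ⟨?_, ?_⟩⟩
  · exact htype.mono (finLevel_antitone W hdvd)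
  · intro k hk x
    exact hinv k (levelK_antitone W hdvd hk) x

/-- **the DEFINED block in tower form** (the binder shape of `defined_inputs_realisable_deepLevel`, p684914): an
adapted ONB and, for every non-zero multiple `N` of one `N₀ ≠ 0`, an isolating pair with `f₁` of finite-rank
left-`finLevel W N`-type and bi-`levelK W N`-invariant. -/
theorem defined_inputs_realisable_finiteRankType_biInvariant_tower (hC : IsCompact (archImage W))
    (hc : Continuous R.chi) (hu : ∀ a, ‖R.chi a‖ = 1) (hc' : Continuous R.chi') (hu' : ∀ a, ‖R.chi' a‖ = 1) :
    ∃ (τ : ℕ → Set (GA W → ℂ)) (φ : ℕ → GA W → ℂ) (n : ℕ → ℕ),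
      (Setting.ofAdelic W hW hg R μ hT hT').IsAdaptedONB τ φ n ∧
      ∃ N₀ : ℕ, N₀ ≠ 0 ∧ ∀ N : ℕ, N ≠ 0 → N₀ ∣ N →
        ∃ (f₁ f₂ : GA W → ℂ) (o₀ : (Setting.ofAdelic W hW hg R μ hT hT').Orbit),
          RTF.IsTest f₁ ∧ RTF.IsTest f₂ ∧ RTF.IsTest ((Setting.ofAdelic W hW hg R μ hT hT').conv f₁ f₂) ∧
          (Setting.ofAdelic W hW hg R μ hT hT').geoSupport ((Setting.ofAdelic W hW hg R μ hT hT').conv f₁ f₂) = {o₀} ∧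
          (Setting.ofAdelic W hW hg R μ hT hT').orbital R.chi R.chi' o₀
            ((Setting.ofAdelic W hW hg R μ hT hT').conv f₁ f₂) ≠ 0 ∧
          RTF.HasFiniteRankLeftType (finLevel W N) f₁ ∧
          ∀ k ∈ levelK W N, ∀ x, f₁ (x * k) = f₁ x ∧ f₁ (k * x) = f₁ x := by
  obtain ⟨τ, φ, n, hB⟩ := exists_adaptedONB W hW hg R μ hT hT'
  obtain ⟨N₀, f₁, f₂, o₀, hN₀, h₁, h₂, hconv, hiso, hne, htower⟩ :=
    exists_isolating_tests_finiteRankType_biInvariant_tower W hW hg R μ hT hT' hC hc hu hc' hu'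
  exact ⟨τ, φ, n, hB, N₀, hN₀, fun N _ hdvd =>
    ⟨f₁, f₂, o₀, h₁, h₂, hconv, hiso, hne, (htower N hdvd).1, (htower N hdvd).2⟩⟩

/-- the tower form with `IsTotallyDefinite W` displayed. -/
theorem exists_isolating_tests_finiteRankType_biInvariant_tower_of_totallyDefinite (htot : IsTotallyDefinite W)
    (hc : Continuous R.chi) (hu : ∀ a, ‖R.chi a‖ = 1) (hc' : Continuous R.chi') (hu' : ∀ a, ‖R.chi' a‖ = 1) :
    ∃ (N₀ : ℕ) (f₁ f₂ : GA W → ℂ) (o₀ : (Setting.ofAdelic W hW hg R μ hT hT').Orbit), N₀ ≠ 0 ∧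
      RTF.IsTest f₁ ∧ RTF.IsTest f₂ ∧ RTF.IsTest ((Setting.ofAdelic W hW hg R μ hT hT').conv f₁ f₂) ∧
      (Setting.ofAdelic W hW hg R μ hT hT').geoSupport ((Setting.ofAdelic W hW hg R μ hT hT').conv f₁ f₂) = {o₀} ∧
      (Setting.ofAdelic W hW hg R μ hT hT').orbital R.chi R.chi' o₀
        ((Setting.ofAdelic W hW hg R μ hT hT').conv f₁ f₂) ≠ 0 ∧
      ∀ N : ℕ, N₀ ∣ N → RTF.HasFiniteRankLeftType (finLevel W N) f₁ ∧
        ∀ k ∈ levelK W N, ∀ x, f₁ (x * k) = f₁ x ∧ f₁ (k * x) = f₁ x :=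
  exists_isolating_tests_finiteRankType_biInvariant_tower W hW hg R μ hT hT'
    (isCompact_archImage_of_totallyDefinite W htot) hc hu hc' hu'

/-- the DEFINED block in tower form with `IsTotallyDefinite W` displayed. -/
theorem defined_inputs_realisable_finiteRankType_biInvariant_tower_of_totallyDefinite (htot : IsTotallyDefinite W)
    (hc : Continuous R.chi) (hu : ∀ a, ‖R.chi a‖ = 1) (hc' : Continuous R.chi') (hu' : ∀ a, ‖R.chi' a‖ = 1) :
    ∃ (τ : ℕ → Set (GA W → ℂ)) (φ : ℕ → GA W → ℂ) (n : ℕ → ℕ),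
      (Setting.ofAdelic W hW hg R μ hT hT').IsAdaptedONB τ φ n ∧
      ∃ N₀ : ℕ, N₀ ≠ 0 ∧ ∀ N : ℕ, N ≠ 0 → N₀ ∣ N →
        ∃ (f₁ f₂ : GA W → ℂ) (o₀ : (Setting.ofAdelic W hW hg R μ hT hT').Orbit),
          RTF.IsTest f₁ ∧ RTF.IsTest f₂ ∧ RTF.IsTest ((Setting.ofAdelic W hW hg R μ hT hT').conv f₁ f₂) ∧
          (Setting.ofAdelic W hW hg R μ hT hT').geoSupport ((Setting.ofAdelic W hW hg R μ hT hT').conv f₁ f₂) = {o₀} ∧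
          (Setting.ofAdelic W hW hg R μ hT hT').orbital R.chi R.chi' o₀
            ((Setting.ofAdelic W hW hg R μ hT hT').conv f₁ f₂) ≠ 0 ∧
          RTF.HasFiniteRankLeftType (finLevel W N) f₁ ∧
          ∀ k ∈ levelK W N, ∀ x, f₁ (x * k) = f₁ x ∧ f₁ (k * x) = f₁ x :=
  defined_inputs_realisable_finiteRankType_biInvariant_tower W hW hg R μ hT hT'
    (isCompact_archImage_of_totallyDefinite W htot) hc hu hc' hu'

end Instance

end Summit.Ventures.HodgeRepro.Tier4.Line1

end
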